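import Literature.AlgebraicGeometry.HodgeTheory.GlobalInvariantCyclesProofs
import Literature.AlgebraicGeometry.HodgeTheory.InvariantClassesFromTotalSpace
import Literature.AlgebraicGeometry.HodgeTheory.MotivatedClassesDeformationInputs
import Literature.AlgebraicGeometry.HodgeTheory.DirectImageBaseChange
import Literature.AlgebraicGeometry.Motives.FlatSubfamily
import Literature.AlgebraicGeometry.Motives.VarietiesProperProofs
import Literature.AlgebraicTopology.SingularHomology.CohomologyBocksteinRepresentatives
import Literature.AlgebraicTopology.SingularHomology.CohomologyScalarChange
import Literature.AlgebraicTopology.SingularHomology.CohomologyRingChangeFunctoriality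
import Literature.AlgebraicTopology.SingularHomology.CohomologyFiniteness
import Literature.AlgebraicTopology.SingularHomology.BettiNumberBaseChange
import Mathlib.AlgebraicGeometry.Morphisms.Immersion
import Mathlib.AlgebraicGeometry.Morphisms.Proper
import Mathlib.LinearAlgebra.Basis.VectorSpace
import Mathlib.LinearAlgebra.Dual.Lemmas
import Mathlib.LinearAlgebra.FiniteDimensional.Lemmas
import HarnessLib

/-!
# Invariant classes come from the total space (Deligne 1968 / Voisin II Thm. 4.18): proved cases

Companion (proof) file of `InvariantClassesFromTotalSpace.lean`, whose named fact
`deligne1968_invariantClass_fromTotalSpace` (Deligne 1968, Prop. (2.1) with (2.6.3); Voisin,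
*Hodge Theory II*, Thm. 4.15 and Thm. 4.18) says, on the real carriers of `HodgeLocus.lean`, that for a
smooth projective family `f : 𝒳 ⟶ S` with quasi-projective total space over a smooth quasi-projective
base, every value `σ(s₀)` of a continuous section `σ` of `FiberClass.pt` is the restriction of a class
of the total space: `σ s₀ = globalSection f k β s₀`, `β ∈ Hᵏ(𝒳(ℂ); ℂ)`.

The cases that need no spectral sequence are exactly those already proved for the partie fixe in
`GlobalInvariantCyclesProofs` (there with a compactification `i : 𝒳 ⟶ 𝒳̄`; here `𝒳̄ = 𝒳`, `i = 𝟙`):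

* `deligne1968_invariantClass_of_isOpen_singleton` — at an ISOLATED point `s₀` of `S(ℂ)` (the
  `0`-dimensional components of the base, trivial monodromy): the fibre `𝒳_{s₀}(ℂ)` is a clopen piece
  of the Hausdorff `𝒳(ℂ)` (`𝒳` quasi-projective, hence separated), so `Hᵏ(𝒳(ℂ); ℂ) → Hᵏ(𝒳_{s₀}(ℂ); ℂ)`
  is onto (`surjective_complexBetti_map_fiberι_comp_of_isOpen_singleton` with `i = 𝟙`);
* `deligne1968_invariantClass_of_lt` — degrees `k > 2n` (fibre classes vanish);
* `deligne1968_invariantClass_zero` — degree `0` (fibres connected, `1 = 1|_{𝒳_s}`);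
* `deligne1968_invariantClass_of_relDim_zero` — hence all degrees in relative dimension `0`.

What remains of the named fact is its content: degrees `1 ≤ k ≤ 2n` at the non-isolated points of
`S(ℂ)`, i.e. the degeneration of the Leray spectral sequence (relative hard Lefschetz) and Ehresmann.

## Reduction to the tree's `ℚ`-form of Voisin II Thm. 4.18 (`Motives.Voisin2003_invariantCycles`)

The same published theorem is vendored a second time in the tree, on other carriers:
`Motives.Voisin2003_invariantCycles` (`Motives/FlatSubfamily.lean`; `ℚ`-coefficients, GLOBAL flat
sections `Motives.IsFlatSection` of `Rᵏ f(ℂ)_* ℚ` rendered on tubes, `f` projective in the sense of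
Def. 4.14: a closed `U`-embedding `𝒳 ↪ U × ℙᵐ`). The second half of this file PROVES that the named
fact of `InvariantClassesFromTotalSpace.lean` follows from that one
(`deligne1968_invariantClass_fromTotalSpace_of_invariantCycles`), so that a single proof of Deligne's
degeneration theorem discharges both. The reduction is the printed passage "the `ℚ`-statement gives the
`ℂ`-one by `⊗ ℂ`" together with Lemma 4.17 / Voisin I §9.2.1 on the real carriers, and consists of:

* `isCohomologicallyLocallyTrivialOn_univ_of_smooth` — **`Rᵏ f_* ℂ` is a local system on all of
  `S(ℂ)`** for a smooth projective family over a smooth (not necessarily equidimensional) separated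
  quasi-compact base: the equidimensional case is the tree's `isCohomologicallyLocallyTrivialOn_univ`
  (Ehresmann on complex points + homotopy invariance, `MotivatedClassesDeformationInputs`); the general
  case follows by splitting `S` into its smooth pieces of constant dimension
  (`Motives.exists_smoothPieces`), base-changing the family to each piece and descending along the
  open immersion (`isCohomologicallyLocallyTrivialOn_range_of_familyPullback`, via
  `DirectImageBaseChange.map_inv_fiberRestrict_eq`);
* `exists_isClosedImmersion_tensor_projectiveSpace_of_isQuasiProjectiveOver` — a proper `f : 𝒳 ⟶ S`
  with quasi-projective source and separated target is projective in the sense of Def. 4.14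
  (`x ↦ (f x, x)` is a closed immersion `𝒳 ⟶ S × ℙᵐ`; Hartshorne II Cor. 4.8 (e));
* the universal-coefficient toolkit for a field extension `K ⊆ L` on the tree's singular cohomology
  (`Literature.AlgebraicTopology.SingularHomology.mapCoeff_scalarChange_smul_ringChange`,
  `linearIndependent_ringChange`, `exists_finset_sum_smul_ringChange_mapCoeff_eq`): coordinates of a
  class of `Hⁿ(Y; L)` along `K`-linear functionals `L → K` (Hatcher §3.1 p. 198, change of
  coefficients on cochains), and the finite expansion `x = ∑_j b_j • ι((b_j^∨)_* x)` of a class with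
  `L`-coefficients against a `K`-basis `(b_j)` of `L` when `dim_K Hⁿ(Y; K) = dim_L Hⁿ(Y; L) < ∞`;
* `isFlatSection_mapCoeff_clsAt` — the coordinate families of a CONTINUOUS section of the espace
  étalé `FiberClass f k` are flat `ℚ`-sections in the tube sense of `Motives.IsFlatSection`
  (continuous maps into the espace étalé are locally tube sections,
  `FiberClass.eventually_eq_fiberRestrict`, and coordinates are natural in the space);
* `deligne1968_invariantClass_fromTotalSpace_of_invariantCycles` — the assembly at a point `s₀`:
  expand `σ(s₀)` in coordinates, lift each flat coordinate section to `Hᵏ(𝒳(ℂ); ℚ)` by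
  `Motives.Voisin2003_invariantCycles`, and recombine in `Hᵏ(𝒳(ℂ); ℂ)`.

Everything below is proved; no definitions, no new named facts. The discharge
`deligne1968_invariantClass_fromTotalSpace_holds` is thereby EXACTLY the open `ℚ`-statement
`Motives.Voisin2003_invariantCycles` (Deligne's degeneration theorem, Voisin II Thm. 4.15).

## References

* P. Deligne, *Théorème de Lefschetz et critères de dégénérescence de suites spectrales*, Publ. Math.
  IHÉS 35 (1968), Prop. (2.1), (2.6.3).
* C. Voisin, *Hodge Theory and Complex Algebraic Geometry II*, Thm. 4.15, Lemma 4.17, Thm. 4.18.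
* C. Voisin, *Hodge Theory and Complex Algebraic Geometry I*, Thm. 9.3, §9.2.1.
* R. Hartshorne, *Algebraic Geometry*, II Cor. 4.8 (e).
* A. Hatcher, *Algebraic Topology*, §3.1 p. 198, Thm. 3.2, §3.A Cor. 3A.4.
-/

noncomputable section

open CategoryTheory AlgebraicGeometry Topology
open Literature.AlgebraicTopology.SingularHomology

universe u

namespace Literature.AlgebraicGeometry.HodgeTheory

variable {𝒳 S : Motives.SchemeOver ℂ}

/-- Restricting along the identity does nothing to a global section:
`globalSection f k ((𝟙 𝒳)^* A) = globalSection f k A`. [folklore] -/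
theorem globalSection_map_id (f : 𝒳 ⟶ S) (k : ℕ) (A : complexBetti 𝒳 k) :
    globalSection f k (complexBetti.map (𝟙 𝒳) k A) = globalSection f k A := by
  rw [complexBetti.map_id]; rfl

/-- **Deligne 1968 / Voisin II Thm. 4.18 at an isolated base point** (no spectral sequence needed):
for `f : 𝒳 ⟶ S` a smooth projective family with quasi-projective (hence separated) total space and
`s₀` an ISOLATED point of `S(ℂ)`, every fibre class over `s₀` — in particular the value `σ s₀` of any
section `σ` of `FiberClass.pt` — is the restriction of a class of the total space: `𝒳_{s₀}(ℂ)` is a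
clopen piece of `𝒳(ℂ)` (`surjective_complexBetti_map_fiberι_comp_of_isOpen_singleton` with `i = 𝟙 𝒳`).
[cite: VoisinHodgeII2003, Thm. 4.18] [cite: Deligne1968, Prop. (2.1) with (2.6.3)] -/
theorem deligne1968_invariantClass_of_isOpen_singleton (f : 𝒳 ⟶ S) {n : ℕ}
    (hf : Motives.IsSmoothProjectiveFamily f n) (h𝒳 : IsQuasiProjectiveOver 𝒳) (k : ℕ)
    (σ : Motives.ComplexPoints S → FiberClass f k) (hpt : ∀ s, (σ s).pt = s)
    {s₀ : Motives.ComplexPoints S} (hs₀ : IsOpen ({s₀} : Set (Motives.ComplexPoints S))) :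
    ∃ β : complexBetti 𝒳 k, σ s₀ = globalSection f k β s₀ := by
  haveI : IsProper f.left := hf.isProper
  haveI : IsSeparated 𝒳.hom := h𝒳.isVarietyPair_ofScheme.isSeparated
  obtain ⟨A, hA⟩ := FiberClass.exists_eq_globalSection_of_forall f k (𝟙 𝒳) (hpt s₀)
    (surjective_complexBetti_map_fiberι_comp_of_isOpen_singleton f (𝟙 𝒳) k hs₀)
  exact ⟨A, by rw [hA, globalSection_map_id]⟩

/-- **Deligne 1968 / Voisin II Thm. 4.18 in degrees `k > 2n`** (trivially): the fibre classes of a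
smooth projective family of relative dimension `n` vanish in degrees `> 2n`
(`deligne_globalInvariantCycles_of_lt` with `i = 𝟙 𝒳`). [cite: VoisinHodgeII2003, Thm. 4.18] -/
theorem deligne1968_invariantClass_of_lt (f : 𝒳 ⟶ S) {n : ℕ}
    (hf : Motives.IsSmoothProjectiveFamily f n) {k : ℕ} (hk : 2 * n < k)
    (σ : Motives.ComplexPoints S → FiberClass f k) (hpt : ∀ s, (σ s).pt = s)
    (s₀ : Motives.ComplexPoints S) :
    ∃ β : complexBetti 𝒳 k, σ s₀ = globalSection f k β s₀ := by
  obtain ⟨A, hA⟩ := deligne_globalInvariantCycles_of_lt f (𝟙 𝒳) hf hk σ hpt s₀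
  exact ⟨A, by rw [hA, globalSection_map_id]⟩

/-- **Deligne 1968 / Voisin II Thm. 4.18 in degree `0`**, at every base point: the fibres are
connected, `H⁰(𝒳_s(ℂ); ℂ) = ℂ · 1` and `1 = 1|_{𝒳_s}` (`deligne_globalInvariantCycles_zero` with
`i = 𝟙 𝒳`; the case where `R⁰ f_* ℂ = ℂ` is constant). [cite: VoisinHodgeII2003, Thm. 4.18] -/
theorem deligne1968_invariantClass_zero (f : 𝒳 ⟶ S) {n : ℕ}
    (hf : Motives.IsSmoothProjectiveFamily f n) (σ : Motives.ComplexPoints S → FiberClass f 0)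
    (hpt : ∀ s, (σ s).pt = s) (s₀ : Motives.ComplexPoints S) :
    ∃ β : complexBetti 𝒳 0, σ s₀ = globalSection f 0 β s₀ := by
  obtain ⟨A, hA⟩ := deligne_globalInvariantCycles_zero f (𝟙 𝒳) hf σ hpt s₀
  exact ⟨A, by rw [hA, globalSection_map_id]⟩

/-- **Deligne 1968 / Voisin II Thm. 4.18 for families of relative dimension `0`** (all degrees, all
base points): degree `0` is `deligne1968_invariantClass_zero`, degrees `k ≥ 1 > 2·0` are
`deligne1968_invariantClass_of_lt`. [cite: VoisinHodgeII2003, Thm. 4.18] -/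
theorem deligne1968_invariantClass_of_relDim_zero (f : 𝒳 ⟶ S)
    (hf : Motives.IsSmoothProjectiveFamily f 0) (k : ℕ)
    (σ : Motives.ComplexPoints S → FiberClass f k) (hpt : ∀ s, (σ s).pt = s)
    (s₀ : Motives.ComplexPoints S) :
    ∃ β : complexBetti 𝒳 k, σ s₀ = globalSection f k β s₀ := by
  rcases k with _ | k
  · exact deligne1968_invariantClass_zero f hf σ hpt s₀
  · exact deligne1968_invariantClass_of_lt f hf (by omega) σ hpt s₀

end Literature.AlgebraicGeometry.HodgeTheory

/-! ## Universal coefficients for a field extension on the tree's singular cohomology -/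

namespace Literature.AlgebraicTopology.SingularHomology

open singularCochainComplex

universe v

section FieldExtension

variable (K : Type v) {L : Type v} [Field K] [Field L] [Algebra K L]
variable {Y Y' : Type u} [TopologicalSpace Y] [TopologicalSpace Y'] {n : ℕ}

/-- **Coordinates of a class with coefficients in a field extension, against the extension of a
class from the small field**: for a `K`-linear functional `g : L → K`, `c ∈ L` and `a ∈ Hⁿ(Y; K)`,
the `g`-coordinate class of `c • ι(a) ∈ Hⁿ(Y; L)` (`ι = (algebraMap K L)_*`) is `g(c) • a` — on a
representing cocycle `w` of `a` both are the cochain `σ ↦ g(c · w σ) = g(c) w σ`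
(Hatcher 2002, §3.1 p. 198: change of coefficients is computed on cochains).
[cite: HatcherAT2002, §3.1 p. 198] -/
theorem mapCoeff_scalarChange_smul_ringChange (g : L →ₗ[K] K) (c : L)
    (a : singularCohomology K K Y n) :
    singularCohomology.mapCoeff Y g n (singularCohomology.scalarChange L K L Y n
      (c • singularCohomology.ringChange (algebraMap K L) Y n a)) = g c • a := by
  induction a using singularCohomology_induction_on with
  | h w =>
    rw [singularCohomology.ringChange_π, ← map_smul, singularCohomology.scalarChange_π,
      singularCohomology.mapCoeff_π, ← map_smul]
    congr 1
    refine cocycles_ext (funext fun σ ↦ ?_)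
    rw [iCocycles_cocyclesMapCoeff_apply]
    have h1 : (iCocycles K L Y n (cocyclesScalarChange L K L n
        (c • cocyclesRingChange (algebraMap K L) n w)) : SingularSimplex Y n → L) σ =
        c * algebraMap K L (coFn w σ) := by
      rw [iCocycles_cocyclesScalarChange, map_smul]
      change (c • coFn (cocyclesRingChange (algebraMap K L) n w)) σ = _
      rw [coFn_cocyclesRingChange]
      rfl
    have h2 : (iCocycles K K Y n (g c • w)) σ = g c * coFn w σ := by
      rw [map_smul]; rfl
    rw [h1, h2, mul_comm c, ← Algebra.smul_def, LinearMap.map_smul, smul_eq_mul, mul_comm]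

/-- The coordinate classes are natural in the space: for continuous `φ : Y → Y'`,
`g`-coordinates commute with `φ^*` (both are computed by composing cochains).
[cite: HatcherAT2002, §3.1 p. 198] -/
theorem mapCoeff_scalarChange_map (g : L →ₗ[K] K) (φ : C(Y, Y'))
    (x : singularCohomology L L Y' n) :
    singularCohomology.mapCoeff Y g n (singularCohomology.scalarChange L K L Y n
      (singularCohomology.map L L φ n x)) =
      singularCohomology.map K K φ n (singularCohomology.mapCoeff Y' g n
        (singularCohomology.scalarChange L K L Y' n x)) := by
  rw [singularCohomology.scalarChange_map, ← ModuleCat.comp_apply,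
    singularCohomology.map_mapCoeff, ModuleCat.comp_apply]

omit [Algebra K L] in
/-- The extension of coefficients `ι = (algebraMap K L)_* : Hⁿ(Y; K) → Hⁿ(Y; L)` is natural in the
space: `ι ∘ φ^* = φ^* ∘ ι` (both send `[w]` to `[algebraMap ∘ w ∘ φ_♯]`).
[cite: HatcherAT2002, §3.1 p. 198] -/
theorem ringChange_map (f : K →+* L) (φ : C(Y, Y')) (a : singularCohomology K K Y' n) :
    singularCohomology.ringChange f Y n (singularCohomology.map K K φ n a) =
      singularCohomology.map L L φ n (singularCohomology.ringChange f Y' n a) := by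
  induction a using singularCohomology_induction_on with
  | h w =>
    rw [singularCohomology.map_π, singularCohomology.ringChange_π, singularCohomology.ringChange_π,
      singularCohomology.map_π]
    congr 1
    refine coFn_injective ?_
    rw [coFn_cocyclesRingChange, coFn_cocyclesMap, coFn_cocyclesMap, coFn_cocyclesRingChange]
    rfl

/-- **Extension of scalars preserves linear independence**: if `(aᵢ)` is `K`-linearly independent
in `Hⁿ(Y; K)` then `(ι aᵢ)` is `L`-linearly independent in `Hⁿ(Y; L)` — apply the `g`-coordinate maps
to a relation `∑ cᵢ • ι(aᵢ) = 0` to get `∑ g(cᵢ) • aᵢ = 0` for every functional `g : L → K`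
(`mapCoeff_scalarChange_smul_ringChange`), and the `K`-linear functionals of `L` separate points
(Hatcher 2002, §3.A: `Hⁿ(X; L) ⊇ Hⁿ(X; K) ⊗_K L`). [cite: HatcherAT2002, §3.A Cor. 3A.4] -/
theorem linearIndependent_ringChange {ι : Type*} [Fintype ι] {a : ι → singularCohomology K K Y n}
    (ha : LinearIndependent K a) :
    LinearIndependent L fun i ↦ singularCohomology.ringChange (algebraMap K L) Y n (a i) := by
  rw [Fintype.linearIndependent_iff] at ha ⊢
  intro c hc i
  refine (Module.forall_dual_apply_eq_zero_iff K (c i)).1 fun g ↦ ?_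
  have h := congrArg (fun x ↦ singularCohomology.mapCoeff Y g n
    (singularCohomology.scalarChange L K L Y n x)) hc
  simp only [map_sum, map_zero, mapCoeff_scalarChange_smul_ringChange] at h
  exact ha (fun i ↦ g (c i)) h i

variable [Module.Finite K (singularCohomology K K Y n)]
  [Module.Finite L (singularCohomology L L Y n)]

/-- **Finite coordinate expansion of a class with coefficients in a field extension.** Let
`K ⊆ L` be fields, `(b_j)` a `K`-basis of `L` with coordinate functionals `b_j^∨`, and assume
`Hⁿ(Y; K)`, `Hⁿ(Y; L)` finite-dimensional of the same dimension (universal coefficients over fields,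
Hatcher Thm. 3.2 / §3.A: `Hⁿ(Y; L) = Hⁿ(Y; K) ⊗_K L`). Then every `x ∈ Hⁿ(Y; L)` is
`∑_{j ∈ s} b_j • ι((b_j^∨)_* x)` for a finite set `s` of indices, where `(b_j^∨)_* x ∈ Hⁿ(Y; K)` is the
`b_j^∨`-coordinate class of `x` and `ι` the extension of coefficients: the extensions of a `K`-basis of
`Hⁿ(Y; K)` form an `L`-basis of `Hⁿ(Y; L)` (`linearIndependent_ringChange` and the dimension count),
and on `x = ∑ cᵢ • ι(aᵢ)` the identity is `∑_{j ∈ s} b_j^∨(cᵢ) b_j = cᵢ` for `s` containing the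
supports of the `cᵢ`. [cite: HatcherAT2002, §3.1 Thm. 3.2 and §3.A Cor. 3A.4] -/
theorem exists_finset_sum_smul_ringChange_mapCoeff_eq
    (hdim : Module.finrank L (singularCohomology L L Y n) =
      Module.finrank K (singularCohomology K K Y n))
    {J : Type*} (bL : Module.Basis J K L) (x : singularCohomology L L Y n) :
    ∃ s : Finset J, ∑ j ∈ s, bL j • singularCohomology.ringChange (algebraMap K L) Y n
      (singularCohomology.mapCoeff Y (bL.coord j) n
        (singularCohomology.scalarChange L K L Y n x)) = x := by
  classical
  -- an `L`-basis of `Hⁿ(Y; L)` made of extended classes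
  set b := Module.finBasis K (singularCohomology K K Y n) with hb
  have hli := linearIndependent_ringChange K (L := L) b.linearIndependent
  have hcard : Fintype.card (Fin (Module.finrank K (singularCohomology K K Y n))) =
      Module.finrank L (singularCohomology L L Y n) := by
    rw [Fintype.card_fin, hdim]
  set B := basisOfLinearIndependentOfCardEqFinrank' _ hli hcard with hB
  set c : Fin (Module.finrank K (singularCohomology K K Y n)) → L := fun i ↦ B.repr x i with hc
  have hx : ∑ i, c i • singularCohomology.ringChange (algebraMap K L) Y n (b i) = x := by
    have := B.sum_repr x
    simpa only [hB, coe_basisOfLinearIndependentOfCardEqFinrank'] using this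
  refine ⟨Finset.univ.biUnion fun i ↦ (bL.repr (c i)).support, ?_⟩
  set s : Finset J := Finset.univ.biUnion fun i ↦ (bL.repr (c i)).support with hs
  -- coordinates of `x`
  have hcoord : ∀ j, singularCohomology.mapCoeff Y (bL.coord j) n
      (singularCohomology.scalarChange L K L Y n x) = ∑ i, bL.coord j (c i) • b i := by
    intro j
    rw [← hx, map_sum, map_sum]
    exact Finset.sum_congr rfl fun i _ ↦ mapCoeff_scalarChange_smul_ringChange K _ _ _
  -- reassemble
  have key : ∀ i, ∑ j ∈ s, (bL.repr (c i) j) • bL j = c i := fun i ↦ by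
    calc ∑ j ∈ s, (bL.repr (c i) j) • bL j
        = Finsupp.linearCombination K bL (bL.repr (c i)) := by
          rw [Finsupp.linearCombination_apply]
          exact (Finsupp.sum_of_support_subset _
            (Finset.subset_biUnion_of_mem (fun i ↦ (bL.repr (c i)).support) (Finset.mem_univ i))
            (fun j q ↦ q • bL j) fun j _ ↦ zero_smul K (bL j)).symm
      _ = c i := bL.linearCombination_repr (c i)
  calc ∑ j ∈ s, bL j • singularCohomology.ringChange (algebraMap K L) Y n
        (singularCohomology.mapCoeff Y (bL.coord j) n (singularCohomology.scalarChange L K L Y n x))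
      = ∑ j ∈ s, ∑ i, (bL.repr (c i) j • bL j) •
          singularCohomology.ringChange (algebraMap K L) Y n (b i) := by
        refine Finset.sum_congr rfl fun j _ ↦ ?_
        rw [hcoord j, map_sum, Finset.smul_sum]
        refine Finset.sum_congr rfl fun i _ ↦ ?_
        rw [ringChange_smul, smul_smul, Module.Basis.coord_apply, Algebra.smul_def, mul_comm]
    _ = ∑ i, (∑ j ∈ s, bL.repr (c i) j • bL j) •
          singularCohomology.ringChange (algebraMap K L) Y n (b i) := by
        rw [Finset.sum_comm]
        exact Finset.sum_congr rfl fun i _ ↦ (Finset.sum_smul).symm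
    _ = x := by
        rw [← hx]
        exact Finset.sum_congr rfl fun i _ ↦ by rw [key i]

end FieldExtension

end Literature.AlgebraicTopology.SingularHomology

/-! ## The reduction of the named fact to `Motives.Voisin2003_invariantCycles` -/

namespace Literature.AlgebraicGeometry.HodgeTheory

open _root_.Topology _root_.Filter MonoidalCategory

section LocalSystem

variable {𝒳 S S' : Motives.SchemeOver ℂ}

/-- Cohomological local triviality is local on the base: if every point of `S(ℂ)` lies in a
cohomologically locally trivial locus, then `π` is cohomologically locally trivial over all of
`S(ℂ)`. [folklore] -/
theorem isCohomologicallyLocallyTrivialOn_univ_of_forall_exists (π : 𝒳 ⟶ S)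
    (h : ∀ t : Motives.ComplexPoints S, ∃ U : Set (Motives.ComplexPoints S),
      t ∈ U ∧ IsCohomologicallyLocallyTrivialOn π U) :
    IsCohomologicallyLocallyTrivialOn π (Set.univ : Set (Motives.ComplexPoints S)) := by
  refine ⟨fun t _ W hW ↦ ?_⟩
  obtain ⟨U, htU, hU⟩ := h t
  obtain ⟨B, hBo, htB, hBW, -, hbij⟩ := hU.exists_nhds_bijective htU W hW
  exact ⟨B, hBo, htB, hBW, Set.subset_univ B, hbij⟩

/-- **Cohomological local triviality descends along an open immersion of bases.** If the
base change `π' : 𝒳 ×_S S' ⟶ S'` of `π` along an open immersion `g : S' ⟶ S` (`S` separated) is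
cohomologically locally trivial over all of `S'(ℂ)`, then `π` is cohomologically locally trivial
over the open `g(S'(ℂ)) ⊆ S(ℂ)`: `g(ℂ)` is an open embedding (SGA1 XII 3.1 (xi)), and over it the
tubes and fibres of `π'` and `π` are identified (`tubeBaseChangeHomeomorph`,
`map_inv_fiberRestrict_eq`).
[cite: VoisinHodgeII2003, §3.1.1 (p. 69)] [cite: SGA1, Exp. XII Prop. 3.1 (xi)] -/
theorem isCohomologicallyLocallyTrivialOn_range_of_familyPullback [IsSeparated S.hom] (π : 𝒳 ⟶ S)
    (g : S' ⟶ S) [IsOpenImmersion g.left]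
    (h : IsCohomologicallyLocallyTrivialOn (Motives.familyPullback.snd π g)
      (Set.univ : Set (Motives.ComplexPoints S'))) :
    IsCohomologicallyLocallyTrivialOn π
      (Set.range
        (Motives.AlgPoints.map g : Motives.ComplexPoints S' → Motives.ComplexPoints S)) := by
  have hg : IsOpenEmbedding
      (Motives.AlgPoints.map g : Motives.ComplexPoints S' → Motives.ComplexPoints S) :=
    Motives.AlgPoints.isOpenEmbedding_map_holds g
  refine ⟨fun t ht W hW ↦ ?_⟩
  obtain ⟨v, rfl⟩ := ht
  haveI : Nonempty (Motives.ComplexPoints S') := ⟨v⟩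
  set φ := hg.toOpenPartialHomeomorph (Motives.AlgPoints.map g) with hφdef
  have hφ : (Motives.AlgPoints.map g : Motives.ComplexPoints S' → Motives.ComplexPoints S) = φ :=
    (hg.toOpenPartialHomeomorph_apply _).symm
  have hW' : (Motives.AlgPoints.map g) ⁻¹' W ∈ 𝓝 v :=
    (Motives.AlgPoints.continuous_map g).continuousAt.preimage_mem_nhds hW
  obtain ⟨B', hB'o, hvB', hB'W, -, hbij⟩ := h.exists_nhds_bijective (Set.mem_univ v) _ hW'
  have hB'src : B' ⊆ φ.source := by
    rw [hφdef, hg.toOpenPartialHomeomorph_source]; exact Set.subset_univ _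
  refine ⟨Motives.AlgPoints.map g '' B', hg.isOpenMap _ hB'o, Set.mem_image_of_mem _ hvB', ?_,
    Set.image_subset_range _ _, fun j s hs ↦ ?_⟩
  · rintro _ ⟨w, hw, rfl⟩
    exact hB'W hw
  · obtain ⟨w, hw, rfl⟩ := hs
    -- `fiberRestrict π (g w) ∘ (h⁻¹)^* = (X_{g w} ≅ X'_w)^* ∘ fiberRestrict π' w`
    have key : ∀ ξ', complexBetti.map (Motives.fiberOverFamilyPullbackIso π g w).inv j
        (fiberRestrict (Motives.familyPullback.snd π g) hw j ξ') =
        fiberRestrict π (Set.mem_image_of_mem _ hw) j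
          (singularCohomology.map ℂ ℂ
            ((tubeBaseChangeHomeomorph π φ hφ hB'src).symm :
              C(tubeOver π (Motives.AlgPoints.map g '' B'),
                tubeOver (Motives.familyPullback.snd π g) B')) j ξ') :=
      fun ξ' ↦ map_inv_fiberRestrict_eq π φ hφ hB'src j ξ' hw
    -- the two outer maps are bijections
    have hiso : Function.Bijective
        (complexBetti.map (Motives.fiberOverFamilyPullbackIso π g w).inv j) := by
      refine Function.bijective_iff_has_inverse.2
        ⟨complexBetti.map (Motives.fiberOverFamilyPullbackIso π g w).hom j, fun x ↦ ?_, fun x ↦ ?_⟩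
      · rw [← ModuleCat.comp_apply, ← complexBetti.map_comp, Iso.hom_inv_id, complexBetti.map_id]
        rfl
      · rw [← ModuleCat.comp_apply, ← complexBetti.map_comp, Iso.inv_hom_id, complexBetti.map_id]
        rfl
    have hhom : Function.Bijective (singularCohomology.map ℂ ℂ
        ((tubeBaseChangeHomeomorph π φ hφ hB'src).symm :
          C(tubeOver π (Motives.AlgPoints.map g '' B'),
            tubeOver (Motives.familyPullback.snd π g) B')) j) :=
      ConcreteCategory.bijective_of_isIso
        (singularCohomology.mapIso ℂ ℂ (tubeBaseChangeHomeomorph π φ hφ hB'src).symm j).hom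
    have hcomp : (fiberRestrict π (Set.mem_image_of_mem _ hw) j :
        singularCohomology ℂ ℂ (tubeOver π (Motives.AlgPoints.map g '' B')) j → _) ∘
        (singularCohomology.map ℂ ℂ
          ((tubeBaseChangeHomeomorph π φ hφ hB'src).symm :
            C(tubeOver π (Motives.AlgPoints.map g '' B'),
              tubeOver (Motives.familyPullback.snd π g) B')) j) =
        (complexBetti.map (Motives.fiberOverFamilyPullbackIso π g w).inv j) ∘
          (fiberRestrict (Motives.familyPullback.snd π g) hw j) :=
      funext fun ξ' ↦ (key ξ').symm
    have hB : Function.Bijective ((fiberRestrict π (Set.mem_image_of_mem _ hw) j :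
        singularCohomology ℂ ℂ (tubeOver π (Motives.AlgPoints.map g '' B')) j → _) ∘
        (singularCohomology.map ℂ ℂ
          ((tubeBaseChangeHomeomorph π φ hφ hB'src).symm :
            C(tubeOver π (Motives.AlgPoints.map g '' B'),
              tubeOver (Motives.familyPullback.snd π g) B')) j)) := by
      rw [hcomp]
      exact hiso.comp (hbij j hw)
    exact (Function.Bijective.of_comp_iff _ hhom).1 hB

/-- **`Rᵏ f_* ℂ` is a local system on all of `S(ℂ)` for a smooth projective family over a smooth
base** — without the equidimensionality of `S` asked by `isCohomologicallyLocallyTrivialOn_univ`: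
`S` is the disjoint union of its open pieces `S_m` smooth of relative dimension `m`
(`Motives.exists_smoothPieces`), the base-changed family over `S_m` is cohomologically locally
trivial over `S_m(ℂ)` (`isCohomologicallyLocallyTrivialOn_univ`: Ehresmann on complex points and
homotopy invariance), and this descends to `f` over the open `S_m(ℂ) ⊆ S(ℂ)`
(`isCohomologicallyLocallyTrivialOn_range_of_familyPullback`). (Voisin I §9.2.1: "`Rᵏ π_* A` is a
local system … the stalk at `t` is canonically isomorphic to `Hᵏ(X_t, A)` by restriction".)
[cite: VoisinHodgeI2002, §9.2.1 (with Thm. 9.3)] -/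
theorem isCohomologicallyLocallyTrivialOn_univ_of_smooth (f : 𝒳 ⟶ S) {n : ℕ}
    (hf : Motives.IsSmoothProjectiveFamily f n) [Smooth S.hom] [IsSeparated S.hom]
    [CompactSpace S.left] :
    IsCohomologicallyLocallyTrivialOn f (Set.univ : Set (Motives.ComplexPoints S)) := by
  haveI : LocallyOfFiniteType S.hom := inferInstance
  haveI : IsLocallyNoetherian S.left := LocallyOfFiniteType.isLocallyNoetherian S.hom
  haveI : IsNoetherian S.left := {}
  obtain ⟨piece, hsm, hcov, -, -⟩ := Motives.exists_smoothPieces S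
  refine isCohomologicallyLocallyTrivialOn_univ_of_forall_exists f fun t ↦ ?_
  obtain ⟨m, hm⟩ := hcov t.pt
  let Sm : Motives.SchemeOver ℂ := Over.mk ((piece m).ι ≫ S.hom)
  let gm : Sm ⟶ S := Over.homMk (piece m).ι
  haveI : IsOpenImmersion gm.left := inferInstanceAs (IsOpenImmersion (piece m).ι)
  haveI : SmoothOfRelativeDimension m Sm.hom := hsm m
  haveI : Smooth Sm.hom := SmoothOfRelativeDimension.smooth m _
  haveI : LocallyOfFiniteType Sm.hom := inferInstance
  haveI : IsSeparated Sm.hom := inferInstanceAs (IsSeparated ((piece m).ι ≫ S.hom))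
  haveI : CompactSpace Sm.left := by
    have h1 : IsCompact ((piece m : S.left.Opens) : Set S.left) :=
      TopologicalSpace.NoetherianSpace.isCompact _
    exact isCompact_iff_compactSpace.mp h1
  have hf' : Motives.IsSmoothProjectiveFamily (Motives.familyPullback.snd f gm) n :=
    hf.familyPullback_snd gm
  haveI := hf'.smoothOfRelativeDimension
  haveI := hf'.isProper
  have hU := isCohomologicallyLocallyTrivialOn_univ (Motives.familyPullback.snd f gm) n m
  refine ⟨_, ?_, isCohomologicallyLocallyTrivialOn_range_of_familyPullback f gm hU⟩
  rw [Motives.AlgPoints.range_map_of_isOpenImmersion_holds gm]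
  change t.pt ∈ ((piece m).ι).opensRange
  rw [Scheme.Opens.opensRange_ι]
  exact hm

/-- `isCohomologicallyLocallyTrivialOn_univ_of_smooth` in the vocabulary of the named facts
`deligne_globalInvariantCycles` / `deligne1968_invariantClass_fromTotalSpace`: a smooth projective
family over a smooth quasi-projective base (no pure-dimensionality of `S`).
[cite: VoisinHodgeI2002, §9.2.1 (with Thm. 9.3)] -/
theorem isCohomologicallyLocallyTrivialOn_univ_of_isQuasiProjectiveOver (f : 𝒳 ⟶ S) {n : ℕ}
    (hf : Motives.IsSmoothProjectiveFamily f n) (hS : IsQuasiProjectiveOver S)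
    (hSs : Smooth S.hom) :
    IsCohomologicallyLocallyTrivialOn f (Set.univ : Set (Motives.ComplexPoints S)) := by
  haveI := hSs
  haveI : IsSeparated S.hom := hS.isVarietyPair_ofScheme.isSeparated
  haveI : QuasiCompact S.hom := hS.isVarietyPair_ofScheme.quasiCompact
  haveI : CompactSpace S.left := QuasiCompact.compactSpace_of_compactSpace S.hom
  exact isCohomologicallyLocallyTrivialOn_univ_of_smooth f hf

end LocalSystem

section Projective

variable {𝒳 S : Motives.SchemeOver ℂ}

/-- **A proper morphism from a quasi-projective scheme is projective** (in Hartshorne's / Voisin's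
sense, Def. 4.14: a closed `S`-embedding `𝒳 ↪ S × ℙᵐ`): if `𝒳 ⊆ P` is open in a projective `P ⊆ ℙᵐ`,
`f : 𝒳 ⟶ S` is proper and `S` is separated, then `x ↦ (f x, x)` is a closed immersion
`𝒳 ⟶ S × ℙᵐ` over `S` — an immersion because its composite with the second projection is the
immersion `𝒳 ⊆ P ⊆ ℙᵐ` (Mathlib `IsImmersion.of_comp`), with closed image because its composite with
the separated first projection is the universally closed `f` (Mathlib
`UniversallyClosed.of_comp_of_isSeparated`). (Hartshorne II Cor. 4.8 (e) with Ex. 4.4; EGA II 5.5.12.)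
[cite: Hartshorne1977, Ch. II Cor. 4.8 (e)] -/
theorem exists_isClosedImmersion_tensor_projectiveSpace_of_isQuasiProjectiveOver (f : 𝒳 ⟶ S)
    [IsProper f.left] [IsSeparated S.hom] (h𝒳 : IsQuasiProjectiveOver 𝒳) :
    ∃ (m : ℕ) (ι : 𝒳 ⟶ S ⊗ Motives.projectiveSpace m ℂ),
      IsClosedImmersion ι.left ∧
        ι ≫ CartesianMonoidalCategory.fst S (Motives.projectiveSpace m ℂ) = f := by
  obtain ⟨P, j, ⟨m, κ, hκ⟩, hj⟩ := h𝒳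
  haveI := hκ
  haveI := hj
  refine ⟨m, CartesianMonoidalCategory.lift f (j ≫ κ), ?_, CartesianMonoidalCategory.lift_fst _ _⟩
  set ι := CartesianMonoidalCategory.lift f (j ≫ κ) with hι
  -- `ι` is an immersion: `ι ≫ snd = j ≫ κ` is one
  have hsnd : ι.left ≫ (CartesianMonoidalCategory.snd S (Motives.projectiveSpace m ℂ)).left =
      j.left ≫ κ.left := by
    rw [← Over.comp_left, CartesianMonoidalCategory.lift_snd, Over.comp_left]
  haveI : IsImmersion
      (ι.left ≫ (CartesianMonoidalCategory.snd S (Motives.projectiveSpace m ℂ)).left) := by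
    rw [hsnd]; infer_instance
  haveI : IsImmersion ι.left :=
    IsImmersion.of_comp ι.left (CartesianMonoidalCategory.snd S (Motives.projectiveSpace m ℂ)).left
  -- `ι` is universally closed: `ι ≫ fst = f` is proper and `fst` is separated
  have hfst : ι.left ≫ (CartesianMonoidalCategory.fst S (Motives.projectiveSpace m ℂ)).left =
      f.left := by
    rw [← Over.comp_left, CartesianMonoidalCategory.lift_fst]
  haveI : IsProper (Motives.projectiveSpace m ℂ).hom := Motives.isProper_projectiveSpace m ℂ
  haveI : IsSeparated (CartesianMonoidalCategory.fst S (Motives.projectiveSpace m ℂ)).left :=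
    inferInstanceAs (IsSeparated (Limits.pullback.fst S.hom (Motives.projectiveSpace m ℂ).hom))
  haveI : UniversallyClosed
      (ι.left ≫ (CartesianMonoidalCategory.fst S (Motives.projectiveSpace m ℂ)).left) := by
    rw [hfst]; infer_instance
  haveI : UniversallyClosed ι.left :=
    UniversallyClosed.of_comp_of_isSeparated ι.left
      (CartesianMonoidalCategory.fst S (Motives.projectiveSpace m ℂ)).left
  exact IsClosedImmersion.of_isPreimmersion ι.left ι.left.isClosedMap.isClosed_range

end Projective

section Reduction

open Literature.AlgebraicGeometry.Motives

variable {𝒳 S : Motives.SchemeOver ℂ}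

/-- **The coordinate families of a continuous section of the espace étalé are flat `ℚ`-sections.**
Let `f : 𝒳 ⟶ S` be cohomologically locally trivial over all of `S(ℂ)` (`Rᵏ f_* ℂ` a local system),
`σ` a continuous section of `FiberClass.pt : FiberClass f k → S(ℂ)` and `g : ℂ → ℚ` a `ℚ`-linear
functional. Then `s ↦ g_*(σ(s)) ∈ Hᵏ(𝒳_s(ℂ); ℚ)` is a flat section of `Rᵏ f(ℂ)_* ℚ` in the tube
sense of `Motives.IsFlatSection`: near every point `σ` is the local section of one tube class `ξ`
(`FiberClass.eventually_eq_fiberRestrict`; Voisin I §9.2.1, "the stalk of `Rᵏ π_* A` at `t` is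
`Hᵏ(X_t, A)` by restriction"), and `g_*` commutes with restriction to the fibres
(`mapCoeff_scalarChange_map`), so the coordinate family is the tube section of `g_* ξ`.
[cite: VoisinHodgeI2002, §9.2.1] [cite: HatcherAT2002, §3.1 p. 198] -/
theorem isFlatSection_mapCoeff_clsAt (f : 𝒳 ⟶ S) (k : ℕ)
    (hU : IsCohomologicallyLocallyTrivialOn f (Set.univ : Set (Motives.ComplexPoints S)))
    {σ : Motives.ComplexPoints S → FiberClass f k} (hσ : Continuous σ) (hpt : ∀ s, (σ s).pt = s)
    (g : ℂ →ₗ[ℚ] ℚ) :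
    Motives.IsFlatSection f k fun s ↦
      singularCohomology.mapCoeff (Motives.ComplexPoints (Motives.fiberOver f s)) g k
        (singularCohomology.scalarChange ℂ ℚ ℂ (Motives.ComplexPoints (Motives.fiberOver f s)) k
          ((σ s).clsAt (hpt s))) := by
  intro s₁
  obtain ⟨B, hBo, hs₁B, -, -, hbij⟩ :=
    hU.exists_nhds_bijective (Set.mem_univ s₁) Set.univ Filter.univ_mem
  have hΦ : Continuous fun s ↦ (⟨s, (σ s).clsAt (hpt s)⟩ : FiberClass f k) := by
    have h : (fun s ↦ (⟨s, (σ s).clsAt (hpt s)⟩ : FiberClass f k)) = σ :=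
      funext fun s ↦ FiberClass.mk_clsAt _ _
    rw [h]
    exact hσ
  obtain ⟨ξ, -, hev⟩ := FiberClass.eventually_eq_fiberRestrict f k hU (γ := id)
    (c := fun s ↦ (σ s).clsAt (hpt s)) hΦ.continuousAt hBo (Set.subset_univ B) hs₁B (hbij k hs₁B)
  set V : Set (Motives.ComplexPoints S) :=
    {s | ∃ hB : s ∈ B, (σ s).clsAt (hpt s) = fiberRestrict f hB k ξ} with hV
  have hVB : V ⊆ B := fun s hs ↦ hs.1
  -- the inclusion of the tube of `Motives.tube f V` into the tube `tubeOver f B`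
  have hmem : ∀ y : Motives.tube f V, (y : Motives.ComplexPoints 𝒳) ∈ tubeOver f B := by
    intro y
    obtain ⟨s, hs, x, hx⟩ := y.2
    rw [mem_tubeOver_iff, ← hx, Motives.AlgPoints.map_map_fiberι]
    exact hVB hs
  let e : C(Motives.tube f V, tubeOver f B) :=
    ⟨fun y ↦ ⟨y.1, hmem y⟩, continuous_subtype_val.subtype_mk _⟩
  refine ⟨V, hev, singularCohomology.mapCoeff (Motives.tube f V) g k
    (singularCohomology.scalarChange ℂ ℚ ℂ (Motives.tube f V) k (singularCohomology.map ℂ ℂ e k ξ)),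
    fun s hs ↦ ?_⟩
  have he : e.comp (Motives.fiberToTube f V s hs) = fiberToTube f (hVB hs) := by
    ext x
    rfl
  rw [Motives.tubeRestrict_def]
  change singularCohomology.map ℚ ℚ (Motives.fiberToTube f V s hs) k
    (singularCohomology.mapCoeff (Motives.tube f V) g k
      (singularCohomology.scalarChange ℂ ℚ ℂ (Motives.tube f V) k
        (singularCohomology.map ℂ ℂ e k ξ))) = _
  beta_reduce
  rw [hs.2, ← mapCoeff_scalarChange_map ℚ g, ← ModuleCat.comp_apply, ← singularCohomology.map_comp,
    he]
  rfl

/-- **Voisin II Thm. 4.18 on the real `ℂ`-carriers from its `ℚ`-form on tubes: the named fact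
`deligne1968_invariantClass_fromTotalSpace` follows from `Motives.Voisin2003_invariantCycles`.**
Given a smooth projective family `f : 𝒳 ⟶ S` with quasi-projective total space over a smooth
quasi-projective `S`, a continuous section `σ` of `FiberClass f k → S(ℂ)` and `s₀ ∈ S(ℂ)`:
`Rᵏ f_* ℂ` is a local system on `S(ℂ)`
(`isCohomologicallyLocallyTrivialOn_univ_of_isQuasiProjectiveOver`); `f` is projective in the sense of
Def. 4.14 (`exists_isClosedImmersion_tensor_projectiveSpace_of_isQuasiProjectiveOver`);
for a `ℚ`-basis `(b_j)` of `ℂ` the coordinate families `s ↦ (b_j^∨)_* σ(s)` are flat `ℚ`-sections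
(`isFlatSection_mapCoeff_clsAt`), hence — this is the `ℚ`-statement of Thm. 4.18 — restrictions of
classes `z_j ∈ Hᵏ(𝒳(ℂ); ℚ)`; and `σ(s₀) = ∑_{j ∈ s} b_j • ι((b_j^∨)_* σ(s₀))` for a finite set `s` of
indices (`exists_finset_sum_smul_ringChange_mapCoeff_eq`, universal coefficients on the compact
manifold `𝒳_{s₀}(ℂ)`: `dim_ℚ Hᵏ(𝒳_{s₀}; ℚ) = dim_ℂ Hᵏ(𝒳_{s₀}; ℂ) < ∞`), so that
`β = ∑_{j ∈ s} b_j • ι(z_j) ∈ Hᵏ(𝒳(ℂ); ℂ)` restricts to `σ(s₀)` ("the printed `ℚ`-statement gives the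
`ℂ`-one by `⊗ ℂ`"). [cite: VoisinHodgeII2003, Thm. 4.18 (with Def. 4.14, Thm. 4.15, Lemma 4.17)]
[cite: VoisinHodgeI2002, §9.2.1] [cite: HatcherAT2002, §3.1 Thm. 3.2 and §3.A Cor. 3A.4] -/
theorem deligne1968_invariantClass_fromTotalSpace_of_invariantCycles
    (hX : Motives.Voisin2003_invariantCycles) : deligne1968_invariantClass_fromTotalSpace := by
  intro 𝒳 S f n hf h𝒳 hS hSs k σ hσ hpt s₀
  classical
  haveI : Smooth S.hom := hSs
  haveI : IsSeparated S.hom := hS.isVarietyPair_ofScheme.isSeparated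
  haveI : QuasiCompact S.hom := hS.isVarietyPair_ofScheme.quasiCompact
  haveI : IsProper f.left := hf.isProper
  have hemb := exists_isClosedImmersion_tensor_projectiveSpace_of_isQuasiProjectiveOver f h𝒳
  have hU := isCohomologicallyLocallyTrivialOn_univ_of_isQuasiProjectiveOver f hf hS hSs
  -- the `ℚ`-statement, applied to flat `ℚ`-sections of this family
  have hXf : ∀ y : ∀ s : Motives.ComplexPoints S, Motives.bettiCohomology (Motives.fiberOver f s) k,
      Motives.IsFlatSection f k y → ∃ z : Motives.bettiCohomology 𝒳 k,
        ∀ s, (Motives.bettiCohomology.map (Motives.fiberι f s) k).hom z = y s :=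
    fun y hy ↦ hX f k hSs inferInstance inferInstance hf.smooth hemb y hy
  -- the class at `s₀`
  set x : complexBetti (Motives.fiberOver f s₀) k := (σ s₀).clsAt (hpt s₀) with hxdef
  have hσ₀ : σ s₀ = ⟨s₀, x⟩ := (FiberClass.mk_clsAt _ _).symm
  -- finiteness and universal coefficients on the compact manifold `𝒳_{s₀}(ℂ)`
  have hXs : Motives.IsSmoothProjective n (Motives.fiberOver f s₀) := hf.isSmoothProjective s₀
  haveI : Module.Finite ℚ
      (singularCohomology ℚ ℚ (Motives.ComplexPoints (Motives.fiberOver f s₀)) k) := by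
    letI := hXs.chartedSpace
    haveI := Motives.ComplexPoints.compactSpace_of_isSmoothProjective hXs
    haveI := Motives.ComplexPoints.t2Space_of_isSmoothProjective hXs
    exact finite_singularCohomology_of_compact_chartedSpace ℚ ℚ (d := 2 * n) k
  haveI : Module.Finite ℂ
      (singularCohomology ℂ ℂ (Motives.ComplexPoints (Motives.fiberOver f s₀)) k) := by
    letI := hXs.chartedSpace
    haveI := Motives.ComplexPoints.compactSpace_of_isSmoothProjective hXs
    haveI := Motives.ComplexPoints.t2Space_of_isSmoothProjective hXs
    exact finite_singularCohomology_of_compact_chartedSpace ℂ ℂ (d := 2 * n) k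
  have hdim :
      Module.finrank ℂ (singularCohomology ℂ ℂ (Motives.ComplexPoints (Motives.fiberOver f s₀)) k) =
        Module.finrank ℚ
          (singularCohomology ℚ ℚ (Motives.ComplexPoints (Motives.fiberOver f s₀)) k) := by
    rw [finrank_singularCohomology_eq_bettiNumber_of_field,
      finrank_singularCohomology_eq_bettiNumber_of_field, bettiNumber_eq_of_algebra ℚ ℂ]
  set bL := Module.Basis.ofVectorSpace ℚ ℂ with hbL
  obtain ⟨sJ, hsum⟩ := exists_finset_sum_smul_ringChange_mapCoeff_eq ℚ hdim bL x
  -- flat coordinate sections and their lifts to `Hᵏ(𝒳(ℂ); ℚ)`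
  have hflat := fun j ↦ isFlatSection_mapCoeff_clsAt f k hU hσ hpt (bL.coord j)
  choose z hz using fun j ↦ hXf _ (hflat j)
  refine ⟨∑ j ∈ sJ, bL j • singularCohomology.ringChange (algebraMap ℚ ℂ)
    (Motives.ComplexPoints 𝒳) k (z j), ?_⟩
  rw [hσ₀]
  change (⟨s₀, x⟩ : FiberClass f k) = ⟨s₀, complexBetti.map (Motives.fiberι f s₀) k _⟩
  rw [FiberClass.mk_eq_mk_iff, map_sum, ← hsum]
  refine Finset.sum_congr rfl fun j _ ↦ ?_
  rw [map_smul]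
  congr 1
  change _ = singularCohomology.map ℂ ℂ
    (Motives.AlgPoints.mapContinuous (L := ℂ) (Motives.fiberι f s₀)) k
      (singularCohomology.ringChange (algebraMap ℚ ℂ) (Motives.ComplexPoints 𝒳) k (z j))
  rw [← ringChange_map, ← hz j s₀]

end Reduction

end Literature.AlgebraicGeometry.HodgeTheory

end
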